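import Mathlib.Analysis.Convex.Contractible
import Mathlib.Geometry.Manifold.HasGroupoid
import Mathlib.Algebra.Polynomial.Roots
import Literature.AlgebraicGeometry.Motives.MonodromyCyclicFamily
import Literature.AlgebraicTopology.SingularHomology.AcyclicPuncture
import Literature.AlgebraicTopology.SingularHomology.OrientationCover
import Literature.AlgebraicTopology.SingularHomology.CollapseMap
import HarnessLib

/-!
# The interval family: a monodromy-cyclic family (non-vacuity of `MonodromyCyclicFamily`)

Topic `Literature/AlgebraicGeometry/Motives`; companion to `MonodromyCyclicFamily.lean` (definition request
`defn-MonodromyCyclicFamily` of route `KontsevichZagierPeriods/GaussManinCertificates`), answering its review: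
"`MonodromyCyclicFamily` has no constructed model in the file … a follow-up construction … should be filed
before a route leans on the structure". Everything here is PROVED; there are no named facts.

## The model

`intervalFamily : PeriodFamily 1` is the product family (`PeriodFamily.ofProduct`) with fixed domain
`σ = (0, 1) ⊆ ℝ¹`, rational parameter interval `J = (0, 1)` and polar polynomial `Q = 1`: the forms are the
polynomial forms `P(x, t) dx`, the period functions `t ↦ ∫₀¹ P(x, t) dx`. Its complex family of pairs is
CONSTANT: `X_t = ℂ¹` (no poles) and `D_t = {0, 1}` for every `t ∈ ℂ`, because the boundary variety (Zariski
closure of the fibrewise frontier `{0, 1} × (0, 1)`) is `{0, 1} × ℂ` (`intervalFamily.mem_boundaryZariski_iff`: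
a complex polynomial vanishing on `{a} × (0, 1)` vanishes on `{a} × ℂ`). Hence the good locus is all of `ℂ`
(`intervalFamily.goodLocus_eq`), and `H₁(X_t, D_t; ℚ) = H₁(ℂ, {0, 1}; ℚ) = ℚ · [0, 1]`
([HuberMullerStachPeriodsIII2015, Lemma 11.2.3]: the naive period `∫₀¹ ω` is the period of the pair
`(𝔸¹, {0, 1})` against the class of `[0, 1]`), the monodromy being trivial.

## Main results

* `MonodromyCyclicFamily.interval : MonodromyCyclicFamily 1` — **the interval family is monodromy-cyclic**
  (`intervalFamily.isMonodromyCyclicAt`), whence `Inhabited (MonodromyCyclicFamily 1)`.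
* Criteria valid for EVERY period family `𝓕 : PeriodFamily n`, `n ≥ 1` (namespace `PeriodFamily`):
  `toLocalInterior : Hₙ(σ̄_{t₀}, ∂σ_{t₀}; ℚ) → Hₙ(ℝⁿ | σ°_{t₀}; ℚ)`;
  `exists_isFundamentalClassOf_of_surjective` — if `toLocalInterior` is surjective, `(σ̄_{t₀}, ∂σ_{t₀})` has a
  fundamental class in the sense of `PeriodFamily.IsFundamentalClassOf` (so `bettiClasses t₀` is non-empty), a
  preimage of the class `μ_{σ̄}` along the compact `σ̄_{t₀}` of [HatcherAT2002, Lemma 3.27 (a)]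
  (`HomologicalOrientation.exists_restrictToPoint_eq_of_isCompact` of the tree, read on `ℝⁿ` through the global
  chart `ℝⁿ ≃ₜ EuclideanSpace ℝ (Fin n)`; `ℝⁿ` is `ℚ`-oriented by `isOrientableOver_of_simplyConnectedSpace`);
  `exists_eq_smul_of_injective` — if moreover the local image map at one interior point is injective, then
  `Hₙ(σ̄_{t₀}, ∂σ_{t₀}; ℚ) = ℚ · φ`.
* Two generic homological lemmas: the five lemma for maps of pairs (`isIso_relativeMap_of_isIso`,
  [HatcherAT2002, §2.1, naturality and exactness of the long exact sequence]) and homotopy inverses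
  (`isIso_map_of_homotopyInverse`, `isIso_map_of_contractibleSpace`).

## Proof of monodromy-cyclicity of the interval family (`t₀ ∈ (0, 1)`)

With `K = σ̄_{t₀} = [0, 1]`, `∂ = {0, 1}`, `U = σ° = (0, 1)`:
1. `toLocalInterior : H₁(K, ∂) → H₁(ℝ | U)` is an isomorphism (`isIso_toLocalInterior`): five lemma, `K` and
   `ℝ` contractible, `{0, 1} ⊆ ℝ ∖ U` a homotopy equivalence (`isIso_map_restrict_Kfr`: retraction `y ↦ 0`
   or `1`, straight-line homotopy). Hence a fundamental class `φ` for a `ℚ`-orientation `μ` of `ℝ`.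
2. The local image map `H₁(K, ∂) → H₁(ℝ | 1/2)` is an isomorphism (`isIso_map_half`, same argument with
   `ℝ ∖ {1/2}`), and `μ_{1/2}` generates `H₁(ℝ | 1/2; ℚ) ≅ ℚ`, so `H₁(K, ∂; ℚ) = ℚ · φ`.
3. `realIncl_* : H₁(K, ∂) → H₁(ℂ, {0, 1})` is an isomorphism (`isIso_map_realIncl`): five lemma, `K` and `ℂ`
   contractible, `∂ → D_{t₀}` a homeomorphism of two-point spaces.
4. So the Betti class `c = realIncl_* φ` spans `H₁(ℂ, {0, 1}; ℚ)`; it lies in its own monodromy orbit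
   (`PeriodFamily.self_mem_monodromyOrbit`, the good locus being `ℂ`), so the orbit spans.

## Design notes

* Mathlib/tree searched: `monodromy`, `fundamental class`, `HomologicalOrientation` constructions (none on
  `Fin n → ℝ`; the tree works with `EuclideanSpace ℝ (Fin n)`, hence the local `singletonChartedSpace` chart),
  `ContractibleSpace` (Mathlib `Convex.contractibleSpace`, `RealTopologicalVectorSpace.contractibleSpace`),
  five-lemma wrappers (pattern of `relativeSingularHomology.isIso_map_snd` in `RelativeHomotopyInvariance.lean`).
* NOT here: the comparison statement "cyclic ∧ period ≡ 0 ⇒ exact relative to the boundary" (deliverable (2) of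
  the request; it needs relative algebraic de Rham cohomology of the pairs `(X_t, D_t)` and the period pairing,
  absent from the tree for these affine pairs) and the packaging of the `ℚ(t)`-space of relative forms with
  `∇ = ∂/∂t` (the file `MonodromyCyclicFamily.lean` provides `derivNum`, `IsStokesExactOn`).

## References

* [HuberMullerStachPeriodsIII2015] A. Huber, S. Müller-Stach, *Periods and Nori motives*, Part III (draft 2015),
  Def. 11.1.1, Lemma 11.2.3 (= Springer 2017, Def. 12.1.1, Lemma 12.2.3).
* [HatcherAT2002] A. Hatcher, *Algebraic Topology*, CUP 2002, §2.1 (Thm. 2.16, Cor. 2.11, Prop. 2.7), §3.3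
  (p. 235, Lemma 3.27, Prop. 3.25).
* [VoisinHodgeII2003] C. Voisin, *Hodge theory and complex algebraic geometry II*, CUP 2003, §3.1.2, Def. 3.13.
* [BochnakCosteRoy1998] J. Bochnak, M. Coste, M.-F. Roy, *Real algebraic geometry*, Springer 1998, §2.1.
-/

noncomputable section

open Set MvPolynomial Topology CategoryTheory CategoryTheory.Limits
open Literature.ModelTheory.ExponentialFields Literature.NumberTheory.Transcendental
open Literature.AlgebraicTopology.SingularHomology

universe u v

namespace Literature.AlgebraicGeometry.Motives

/-! ### Two homological lemmas: the five lemma for maps of pairs, homotopy equivalences -/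

section Homology

variable (R : Type v) [CommRing R] (M : Type v) [AddCommGroup M] [Module R M]
variable {X Y : Type u} [TopologicalSpace X] [TopologicalSpace Y]

/-- **Five lemma for maps of pairs.** If `f : (X, A) → (Y, B)` induces isomorphisms `Hₖ(X) ≅ Hₖ(Y)`
and `Hₖ(A) ≅ Hₖ(B)` for all `k`, then `f_* : Hₙ(X, A; M) → Hₙ(Y, B; M)` is an isomorphism for all `n`
(naturality and exactness of the long exact sequences of the pairs, [HatcherAT2002, §2.1, Thm. 2.16 ff.]).
[cite: HatcherAT2002, §2.1 Thm. 2.16] -/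
theorem isIso_relativeMap_of_isIso {A : Set X} {B : Set Y} (f : C(X, Y)) (h : MapsTo f A B)
    (hX : ∀ k, IsIso (singularHomology.map R M f k))
    (hA : ∀ k, IsIso (singularHomology.map R M (subsetRestrict f h) k)) (n : ℕ) :
    IsIso (relativeSingularHomology.map R M f h n) := by
  have hS₁ := relativeSingularChainComplex.shortExact_subsetι_π R M X A
  have hS₂ := relativeSingularChainComplex.shortExact_subsetι_π R M Y B
  let φ := relativeSingularChainComplex.shortComplexMap R M f h
  have hτ₁ : ∀ k, IsIso (HomologicalComplex.homologyMap φ.τ₁ k) := fun k => hA k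
  have hτ₂ : ∀ k, IsIso (HomologicalComplex.homologyMap φ.τ₂ k) := fun k => hX k
  change IsIso (HomologicalComplex.homologyMap φ.τ₃ n)
  haveI := hτ₁ n
  exact HomologicalComplex.HomologySequence.isIso_homologyMap_τ₃ φ hS₁ hS₂ n inferInstance
    (hτ₂ n) (fun j _ => hτ₁ j) (fun j _ => by haveI := hτ₂ j; infer_instance)

/-- A map with a homotopy inverse induces isomorphisms on singular homology
([HatcherAT2002, Cor. 2.11]). [cite: HatcherAT2002, Cor. 2.11] -/
theorem isIso_map_of_homotopyInverse (f : C(X, Y)) (g : C(Y, X))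
    (hgf : (g.comp f).Homotopic (ContinuousMap.id X)) (hfg : (f.comp g).Homotopic (ContinuousMap.id Y))
    (k : ℕ) : IsIso (singularHomology.map R M f k) :=
  ⟨⟨singularHomology.map R M g k,
    by rw [← singularHomology.map_comp, singularHomology.map_eq_of_homotopic R M hgf,
      singularHomology.map_id],
    by rw [← singularHomology.map_comp, singularHomology.map_eq_of_homotopic R M hfg,
      singularHomology.map_id]⟩⟩

/-- Any map between contractible spaces induces isomorphisms on singular homology (both sides vanish in
positive degrees, [HatcherAT2002, §2.1, Ex. 2.5 ff.], and `H₀` of path-connected spaces, Prop. 2.7).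
[cite: HatcherAT2002, Prop. 2.7] -/
theorem isIso_map_of_contractibleSpace [ContractibleSpace X] [ContractibleSpace Y] (f : C(X, Y))
    (k : ℕ) : IsIso (singularHomology.map R M f k) := by
  rcases k with _ | k
  · exact singularHomology.isIso_map_zero_of_pathConnectedSpace R M f
  · exact IsZero.isIso (isZero_singularHomology_of_contractibleSpace R M (Nat.succ_ne_zero k))
      (isZero_singularHomology_of_contractibleSpace R M (Nat.succ_ne_zero k)) _

end Homology

/-! ### Orientations of `ℝⁿ` and classes along compact sets -/

/-- `ℝⁿ = (Fin n → ℝ)` is homeomorphic to Mathlib's model `EuclideanSpace ℝ (Fin n)` of the `n`-manifold `ℝⁿ`.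
[folklore] -/
def euclideanHomeomorph (n : ℕ) : (Fin n → ℝ) ≃ₜ EuclideanSpace ℝ (Fin n) :=
  (EuclideanSpace.equiv (Fin n) ℝ).symm.toHomeomorph

/-- **`ℝⁿ` is `ℚ`-oriented and every compact `K ⊆ ℝⁿ` carries a class `μ_K ∈ Hₙ(ℝⁿ | K; ℚ)`** restricting to
the local orientations at the points of `K` (`n ≥ 1`): orientability of the simply connected manifold `ℝⁿ`
[HatcherAT2002, Prop. 3.25] and [HatcherAT2002, Lemma 3.27 (a)], both proved in the tree
(`isOrientableOver_of_simplyConnectedSpace`, `HomologicalOrientation.exists_restrictToPoint_eq_of_isCompact`),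
read through the global chart `ℝⁿ ≃ₜ EuclideanSpace ℝ (Fin n)`. [cite: HatcherAT2002, Lemma 3.27] -/
theorem exists_orientation_forall_isCompact {n : ℕ} (hn : 1 ≤ n) :
    ∃ μ : HomologicalOrientation ℚ (Fin n → ℝ) n, ∀ K : Set (Fin n → ℝ), IsCompact K →
      ∃ α : localHomologyOfSet ℚ ℚ (Fin n → ℝ) K n,
        ∀ (x : Fin n → ℝ) (hx : x ∈ K), restrictToPoint ℚ ℚ hx n α = μ.localClass x := by
  letI : ChartedSpace (EuclideanSpace ℝ (Fin n)) (Fin n → ℝ) :=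
    (euclideanHomeomorph n).toOpenPartialHomeomorph.singletonChartedSpace rfl
  obtain ⟨μ⟩ := isOrientableOver_of_simplyConnectedSpace ℚ (Fin n → ℝ) (n := n)
  exact ⟨μ, fun K hK => μ.exists_restrictToPoint_eq_of_isCompact hn hK⟩

/-! ### Fundamental classes of the fibre closures of a period family: a criterion -/

namespace PeriodFamily

variable {n : ℕ} (𝓕 : PeriodFamily n)

/-- The inclusion `σ̄_{t₀} ⊆ ℝⁿ` as a continuous map. [folklore] -/
abbrev valK (t₀ : ℝ) : C(𝓕.K t₀, Fin n → ℝ) := ⟨Subtype.val, continuous_subtype_val⟩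

/-- `σ̄_{t₀} ⊆ ℝⁿ` is a map of pairs `(σ̄_{t₀}, ∂σ_{t₀}) → (ℝⁿ, ℝⁿ ∖ σ°_{t₀})` (`∂σ = σ̄ ∖ σ°`). [folklore] -/
theorem mapsTo_valK_compl_interior (t₀ : ℝ) :
    MapsTo (𝓕.valK t₀) (𝓕.Kfr t₀) (interior (𝓕.fibre t₀))ᶜ := fun _ hx h => hx.2 h

/-- The map `Hₙ(σ̄_{t₀}, ∂σ_{t₀}; ℚ) → Hₙ(ℝⁿ | σ°_{t₀}; ℚ)` to the local homology of `ℝⁿ` at the fibre interior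
([HatcherAT2002, §3.3, p. 253]: a relative fundamental class is read in the groups `Hₙ(M | x)`).
[cite: HatcherAT2002, §3.3 p. 253] -/
def toLocalInterior (t₀ : ℝ) :
    relativeSingularHomology ℚ ℚ (𝓕.K t₀) (𝓕.Kfr t₀) n ⟶
      localHomologyOfSet ℚ ℚ (Fin n → ℝ) (interior (𝓕.fibre t₀)) n :=
  relativeSingularHomology.map ℚ ℚ (𝓕.valK t₀) (𝓕.mapsTo_valK_compl_interior t₀) n

/-- Restricting `toLocalInterior φ` to an interior point `x` gives the local image of `φ` at `x` (functoriality).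
[folklore] -/
theorem restrictToPoint_toLocalInterior (t₀ : ℝ) {x : Fin n → ℝ} (hx : x ∈ interior (𝓕.fibre t₀))
    (φ : relativeSingularHomology ℚ ℚ (𝓕.K t₀) (𝓕.Kfr t₀) n) :
    restrictToPoint ℚ ℚ hx n (𝓕.toLocalInterior t₀ φ) =
      relativeSingularHomology.map ℚ ℚ (𝓕.valK t₀) (𝓕.mapsTo_subtype_val_Kfr t₀ hx) n φ := by
  rw [toLocalInterior, ← ModuleCat.comp_apply, restrictToPoint, restrictLocal,
    ← relativeSingularHomology.map_comp]
  rfl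

/-- `IsFundamentalClassOf` read through `toLocalInterior`. [folklore] -/
theorem isFundamentalClassOf_iff (t₀ : ℝ) (μ : HomologicalOrientation ℚ (Fin n → ℝ) n)
    (φ : relativeSingularHomology ℚ ℚ (𝓕.K t₀) (𝓕.Kfr t₀) n) :
    𝓕.IsFundamentalClassOf t₀ μ φ ↔
      ∀ (x : Fin n → ℝ) (hx : x ∈ interior (𝓕.fibre t₀)),
        restrictToPoint ℚ ℚ hx n (𝓕.toLocalInterior t₀ φ) = μ.localClass x := by
  simp only [IsFundamentalClassOf, restrictToPoint_toLocalInterior]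

/-- **Criterion for fundamental classes** (`n ≥ 1`): if `toLocalInterior` is surjective, the fibre closure
`(σ̄_{t₀}, ∂σ_{t₀})` has a fundamental class for some `ℚ`-orientation of `ℝⁿ` — a preimage of the restriction to
`σ°_{t₀}` of the class `μ_{σ̄_{t₀}}` along the compact `σ̄_{t₀}` of [HatcherAT2002, Lemma 3.27 (a)].
[cite: HatcherAT2002, Lemma 3.27] -/
theorem exists_isFundamentalClassOf_of_surjective (hn : 1 ≤ n) (t₀ : ℝ)
    (hsurj : Function.Surjective (𝓕.toLocalInterior t₀)) :
    ∃ (μ : HomologicalOrientation ℚ (Fin n → ℝ) n) (φ : relativeSingularHomology ℚ ℚ (𝓕.K t₀) (𝓕.Kfr t₀) n),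
      𝓕.IsFundamentalClassOf t₀ μ φ := by
  obtain ⟨μ, hμ⟩ := exists_orientation_forall_isCompact hn
  obtain ⟨α, hα⟩ := hμ _ (𝓕.isCompact_closure_fibre t₀)
  have hsub : interior (𝓕.fibre t₀) ⊆ closure (𝓕.fibre t₀) := interior_subset.trans subset_closure
  obtain ⟨φ, hφ⟩ := hsurj (restrictLocal ℚ ℚ hsub n α)
  refine ⟨μ, φ, (𝓕.isFundamentalClassOf_iff t₀ μ φ).2 fun x hx => ?_⟩
  rw [hφ, restrictToPoint_restrictLocal_apply ℚ ℚ hsub hx]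
  exact hα x (hsub hx)

/-- **Spanning criterion.** If `φ` is a fundamental class for `μ` and the local image map at one interior point
`x₀` is injective, then `Hₙ(σ̄_{t₀}, ∂σ_{t₀}; ℚ) = ℚ · φ` (`μ_{x₀}` generates `Hₙ(ℝⁿ | x₀; ℚ) ≅ ℚ`,
[HatcherAT2002, §3.3, p. 235]). [cite: HatcherAT2002, §3.3 p. 235] -/
theorem exists_eq_smul_of_injective (t₀ : ℝ) {μ : HomologicalOrientation ℚ (Fin n → ℝ) n}
    {φ : relativeSingularHomology ℚ ℚ (𝓕.K t₀) (𝓕.Kfr t₀) n} (hφ : 𝓕.IsFundamentalClassOf t₀ μ φ)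
    {x₀ : Fin n → ℝ} (hx₀ : x₀ ∈ interior (𝓕.fibre t₀))
    (hinj : Function.Injective
      (relativeSingularHomology.map ℚ ℚ (𝓕.valK t₀) (𝓕.mapsTo_subtype_val_Kfr t₀ hx₀) n))
    (u : relativeSingularHomology ℚ ℚ (𝓕.K t₀) (𝓕.Kfr t₀) n) : ∃ q : ℚ, u = q • φ := by
  obtain ⟨e, he⟩ := μ.isGenerator x₀
  refine ⟨e (relativeSingularHomology.map ℚ ℚ (𝓕.valK t₀) (𝓕.mapsTo_subtype_val_Kfr t₀ hx₀) n u),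
    hinj ?_⟩
  rw [map_smul, hφ x₀ hx₀]
  apply e.injective
  rw [map_smul, he, smul_eq_mul, mul_one]

end PeriodFamily

/-! ### Coordinate sets in `ℝ¹ = (Fin 1 → ℝ)` -/

/-- The set of points of `ℝ¹` whose coordinate lies in `s ⊆ ℝ`. [folklore] -/
def coordSet (s : Set ℝ) : Set (Fin 1 → ℝ) := {x | x 0 ∈ s}

/-- Membership in a coordinate set. [folklore] -/
@[simp] theorem mem_coordSet_iff {s : Set ℝ} {x : Fin 1 → ℝ} : x ∈ coordSet s ↔ x 0 ∈ s := Iff.rfl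

/-- A coordinate set is the preimage of `s` under the homeomorphism `ℝ¹ ≃ₜ ℝ`. [folklore] -/
theorem coordSet_eq_preimage (s : Set ℝ) : coordSet s = (Homeomorph.funUnique (Fin 1) ℝ) ⁻¹' s := rfl

/-- Closure of a coordinate set. [folklore] -/
theorem closure_coordSet (s : Set ℝ) : closure (coordSet s) = coordSet (closure s) := by
  rw [coordSet_eq_preimage, coordSet_eq_preimage, Homeomorph.preimage_closure]

/-- Interior of a coordinate set. [folklore] -/
theorem interior_coordSet (s : Set ℝ) : interior (coordSet s) = coordSet (interior s) := by
  rw [coordSet_eq_preimage, coordSet_eq_preimage, Homeomorph.preimage_interior]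

/-- Frontier of a coordinate set. [folklore] -/
theorem frontier_coordSet (s : Set ℝ) : frontier (coordSet s) = coordSet (frontier s) := by
  rw [coordSet_eq_preimage, coordSet_eq_preimage, Homeomorph.preimage_frontier]

/-- Points of `ℝ¹` are determined by their coordinate. [folklore] -/
theorem fin1_eq_iff {x y : Fin 1 → ℝ} : x = y ↔ x 0 = y 0 :=
  ⟨fun h => by rw [h], fun h => funext fun i => by rw [Subsingleton.elim i 0]; exact h⟩

/-- The open unit box `(0, 1) ⊆ ℝ¹` is `ℚ`-semialgebraic. [cite: BochnakCosteRoy1998, §2.1] -/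
theorem isSemialgebraic_coordSet_Ioo : IsSemialgebraic ℚ (coordSet (Ioo (0 : ℝ) 1)) := by
  have h1 : IsSemialgebraic ℚ {x : Fin 1 → ℝ | (0 : ℝ) < x 0} := by
    simpa using isSemialgebraic_setOf_eval_lt (k := ℚ) (R := ℝ)
      (C 0 : MvPolynomial (Fin 1) ℚ) (MvPolynomial.X 0)
  have h2 : IsSemialgebraic ℚ {x : Fin 1 → ℝ | x 0 < 1} := by
    simpa using isSemialgebraic_setOf_eval_lt (k := ℚ) (R := ℝ)
      (MvPolynomial.X 0) (C 1 : MvPolynomial (Fin 1) ℚ)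
  convert h1.inter h2 using 1
  ext x
  simp

/-- The open unit box is bounded. [folklore] -/
theorem isBounded_coordSet_Ioo : Bornology.IsBounded (coordSet (Ioo (0 : ℝ) 1)) := by
  refine (Metric.isBounded_iff_subset_closedBall 0).2 ⟨1, fun x hx => ?_⟩
  rw [mem_closedBall_zero_iff, pi_norm_le_iff_of_nonneg zero_le_one]
  intro i
  rw [Subsingleton.elim i 0, Real.norm_eq_abs, abs_le]
  simp only [mem_coordSet_iff, mem_Ioo] at hx
  constructor <;> linarith [hx.1, hx.2]

/-! ### The interval family -/

/-- **The interval family**: fibre dimension `1`, total domain `(0, 1) × (0, 1)` (fibres `σ_t = (0, 1)` for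
`t ∈ J = (0, 1)`), polar polynomial `Q = 1` (forms `P(x, t) dx`, e.g. the period function
`∫₀¹ dx = 1` or `∫₀¹ 2tx dx = t`); the family of pairs is `(ℂ, {0, 1})` for every `t`
([HuberMullerStachPeriodsIII2015, Lemma 11.2.3]: `H₁(ℂ, {0, 1}; ℚ) = ℚ · [0, 1]`).
[cite: HuberMullerStachPeriodsIII2015, Def. 11.1.1] -/
def intervalFamily : PeriodFamily 1 :=
  PeriodFamily.ofProduct (coordSet (Ioo (0 : ℝ) 1)) isSemialgebraic_coordSet_Ioo isBounded_coordSet_Ioo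
    0 1 zero_lt_one 1 (fun _ _ _ _ => by simp)

namespace intervalFamily

/-- The parameter interval of the interval family is `(0, 1)`. [folklore] -/
theorem mem_J_iff {t : ℝ} : t ∈ intervalFamily.J ↔ t ∈ Ioo (0 : ℝ) 1 := by
  simp [PeriodFamily.J, intervalFamily, PeriodFamily.ofProduct]

/-- The polar polynomial of the interval family is `1`. [folklore] -/
@[simp] theorem polar_eq : intervalFamily.polar = 1 := rfl

/-- The fibres of the interval family over `J` are the open unit box. [folklore] -/
theorem fibre_eq {t : ℝ} (ht : t ∈ Ioo (0 : ℝ) 1) : intervalFamily.fibre t = coordSet (Ioo (0 : ℝ) 1) :=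
  PeriodFamily.fibre_ofProduct _ _ zero_lt_one _ _ (by simpa using ht)

/-- The fibre closures are the closed unit box. [folklore] -/
theorem closure_fibre_eq {t : ℝ} (ht : t ∈ Ioo (0 : ℝ) 1) :
    closure (intervalFamily.fibre t) = coordSet (Icc (0 : ℝ) 1) := by
  rw [fibre_eq ht, closure_coordSet, closure_Ioo zero_ne_one]

/-- The fibre interiors are the open unit box. [folklore] -/
theorem interior_fibre_eq {t : ℝ} (ht : t ∈ Ioo (0 : ℝ) 1) :
    interior (intervalFamily.fibre t) = coordSet (Ioo (0 : ℝ) 1) := by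
  rw [fibre_eq ht, interior_coordSet, interior_Ioo]

/-- The fibre frontiers are the two points `{0, 1}`. [folklore] -/
theorem frontier_fibre_eq {t : ℝ} (ht : t ∈ Ioo (0 : ℝ) 1) :
    frontier (intervalFamily.fibre t) = coordSet {0, 1} := by
  rw [fibre_eq ht, frontier_coordSet, frontier_Ioo zero_lt_one]

/-- The complex fibres are all of `ℂ¹` (no polar hypersurface). [folklore] -/
theorem X_eq (t : ℂ) : intervalFamily.X t = univ := by
  ext z
  simp [PeriodFamily.X]

/-- The fibrewise frontier of the interval family is `{0, 1} × (0, 1)`. [folklore] -/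
theorem mem_relFrontier_iff {z : Fin 2 → ℝ} :
    z ∈ intervalFamily.relFrontier ↔ z 1 ∈ Ioo (0 : ℝ) 1 ∧ (z 0 = 0 ∨ z 0 = 1) := by
  simp only [PeriodFamily.relFrontier, mem_setOf_eq]
  have hl : (Fin.last 1) = 1 := rfl
  rw [hl, mem_J_iff]
  constructor
  · rintro ⟨h1, h2⟩
    rw [frontier_fibre_eq h1] at h2
    simpa [Fin.init] using And.intro h1 h2
  · rintro ⟨h1, h2⟩
    refine ⟨h1, ?_⟩
    rw [frontier_fibre_eq h1]
    simpa [Fin.init] using h2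

/-! ### The boundary variety, the boundary `D_t` and the good locus of the interval family -/

/-- The first coordinate of `(z, t) ∈ ℂ²`. [folklore] -/
theorem snoc_apply_zero {α : Type*} (v : Fin 1 → α) (t : α) : (Fin.snoc v t : Fin 2 → α) 0 = v 0 :=
  Fin.snoc_castSucc (α := fun _ => α) t v 0

/-- **The boundary variety of the interval family is `{0, 1} × ℂ`**: a complex polynomial vanishing on
`{0, 1} × (0, 1)` vanishes on `{0, 1} × ℂ` (a one-variable polynomial with infinitely many roots is zero), and
`X₀ (X₀ − 1)` vanishes on the fibrewise frontier. [folklore] -/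
theorem mem_boundaryZariski_iff {w : Fin 2 → ℂ} :
    w ∈ intervalFamily.boundaryZariski ↔ w 0 = 0 ∨ w 0 = 1 := by
  constructor
  · intro hw
    have h := hw (MvPolynomial.X 0 * (MvPolynomial.X 0 - 1)) (fun z hz => by
      rcases (mem_relFrontier_iff.mp hz).2 with h0 | h0 <;> simp [h0])
    simpa [sub_eq_zero] using h
  · intro hw p hp
    obtain ⟨a, ha, haw⟩ : ∃ a : ℝ, (a = 0 ∨ a = 1) ∧ (a : ℂ) = w 0 := by
      rcases hw with h | h
      · exact ⟨0, Or.inl rfl, by simp [h]⟩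
      · exact ⟨1, Or.inr rfl, by simp [h]⟩
    -- substitute `X₀ ↦ a`, `X₁ ↦ T`: a one-variable polynomial `q(T) = p(a, T)`
    set q : Polynomial ℂ :=
      aeval (Fin.cons (Polynomial.C (a : ℂ)) (fun _ => Polynomial.X) : Fin 2 → Polynomial ℂ) p with hq
    have hqeval : ∀ s : ℂ,
        Polynomial.eval s q = aeval (Fin.cons (a : ℂ) (fun _ => s) : Fin 2 → ℂ) p := by
      intro s
      rw [hq, ← Polynomial.coe_aeval_eq_eval, ← AlgHom.comp_apply, MvPolynomial.comp_aeval]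
      congr 1
      ext i
      refine Fin.cases ?_ (fun j => ?_) i
      · simp
      · simp
    have hq0 : q = 0 := by
      apply Polynomial.eq_zero_of_infinite_isRoot
      have hsub : ((fun t : ℝ => (t : ℂ)) '' Ioo (0 : ℝ) 1) ⊆ {x | Polynomial.IsRoot q x} := by
        rintro _ ⟨t, ht, rfl⟩
        have hz : (Fin.cons a (fun _ => t) : Fin 2 → ℝ) ∈ intervalFamily.relFrontier := by
          rw [mem_relFrontier_iff]
          exact ⟨by simpa using ht, by simpa using ha⟩
        have h0 := hp _ hz
        simp only [mem_setOf_eq, Polynomial.IsRoot.def, hqeval]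
        convert h0 using 2
        ext i
        refine Fin.cases ?_ (fun j => ?_) i <;> simp
      exact ((Ioo_infinite zero_lt_one).image Complex.ofReal_injective.injOn).mono hsub
    have hw' : w = Fin.cons (a : ℂ) (fun _ => w 1) := by
      ext i
      refine Fin.cases ?_ (fun j => ?_) i
      · simp [haw]
      · simp [Subsingleton.elim j 0]
    rw [hw', ← hqeval, hq0, Polynomial.eval_zero]

/-- The boundary `D_t ⊆ X_t = ℂ¹` of the interval family is `{0, 1}`, for every `t ∈ ℂ`. [folklore] -/
theorem mem_D_iff {t : ℂ} {z : intervalFamily.X t} :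
    z ∈ intervalFamily.D t ↔ (z : Fin 1 → ℂ) 0 = 0 ∨ (z : Fin 1 → ℂ) 0 = 1 := by
  change (Fin.snoc (z : Fin 1 → ℂ) t : Fin 2 → ℂ) ∈ intervalFamily.boundaryZariski ↔ _
  rw [mem_boundaryZariski_iff, snoc_apply_zero]

/-- The (tautological) trivialisation of the constant family of pairs `(ℂ, {0, 1})` over all of `ℂ`.
[folklore] -/
def pairTrivialisation (t : ℂ) : intervalFamily.XOver univ ≃ₜ ↥(univ : Set ℂ) × intervalFamily.X t where
  toFun p := (⟨(p : ℂ × (Fin 1 → ℂ)).1, mem_univ _⟩,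
    ⟨(p : ℂ × (Fin 1 → ℂ)).2, by rw [X_eq]; exact mem_univ _⟩)
  invFun q := ⟨((q.1 : ℂ), (q.2 : Fin 1 → ℂ)), ⟨mem_univ _, by rw [X_eq]; exact mem_univ _⟩⟩
  left_inv _ := rfl
  right_inv _ := rfl
  continuous_toFun :=
    Continuous.prodMk (Continuous.subtype_mk (continuous_fst.comp continuous_subtype_val) _)
      (Continuous.subtype_mk (continuous_snd.comp continuous_subtype_val) _)
  continuous_invFun :=
    Continuous.subtype_mk (Continuous.prodMk (continuous_subtype_val.comp continuous_fst)
      (continuous_subtype_val.comp continuous_snd)) _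

/-- The family of pairs of the interval family is trivial over all of `ℂ`. [folklore] -/
theorem isPairTrivialOver_univ (t : ℂ) : intervalFamily.IsPairTrivialOver univ t := by
  refine ⟨pairTrivialisation t, fun _ => rfl, fun p => ?_⟩
  change (Fin.snoc (p : ℂ × (Fin 1 → ℂ)).2 (p : ℂ × (Fin 1 → ℂ)).1 : Fin 2 → ℂ) ∈
      intervalFamily.boundaryZariski ↔ _ ∈ intervalFamily.D t
  rw [mem_boundaryZariski_iff, mem_D_iff, snoc_apply_zero]
  rfl

/-- **The good locus of the interval family is all of `ℂ`.** [folklore] -/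
theorem goodLocus_eq : intervalFamily.goodLocus = univ :=
  eq_univ_of_forall fun t => ⟨univ, Filter.univ_mem, isPairTrivialOver_univ t⟩

/-! ### The fibre closure `[0, 1]`, its boundary `{0, 1}` and the complex fibre `ℂ` -/

section Fibre

variable {t₀ : ℝ} (ht : t₀ ∈ Ioo (0 : ℝ) 1)
include ht

/-- Coordinates of points of the fibre closure lie in `[0, 1]`. [folklore] -/
theorem coord_mem_Icc (x : intervalFamily.K t₀) : (x : Fin 1 → ℝ) 0 ∈ Icc (0 : ℝ) 1 :=
  (closure_fibre_eq ht).subset x.2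

/-- Membership in the boundary `∂σ_{t₀} = {0, 1}`. [folklore] -/
theorem mem_Kfr_iff (x : intervalFamily.K t₀) :
    x ∈ intervalFamily.Kfr t₀ ↔ (x : Fin 1 → ℝ) 0 = 0 ∨ (x : Fin 1 → ℝ) 0 = 1 := by
  change (x : Fin 1 → ℝ) ∈ frontier (intervalFamily.fibre t₀) ↔ _
  rw [frontier_fibre_eq ht]
  simp

/-- The point of the fibre closure with coordinate `a ∈ [0, 1]`. [folklore] -/
def kpt (a : ℝ) (ha : a ∈ Icc (0 : ℝ) 1) : intervalFamily.K t₀ :=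
  ⟨fun _ => a, by rw [closure_fibre_eq ht]; simpa using ha⟩

/-- The boundary point `0`. [folklore] -/
def bpt₀ : intervalFamily.Kfr t₀ :=
  ⟨kpt ht 0 ⟨le_rfl, zero_le_one⟩, (mem_Kfr_iff ht _).2 (Or.inl rfl)⟩

/-- The boundary point `1`. [folklore] -/
def bpt₁ : intervalFamily.Kfr t₀ :=
  ⟨kpt ht 1 ⟨zero_le_one, le_rfl⟩, (mem_Kfr_iff ht _).2 (Or.inr rfl)⟩

/-- The fibre closure `[0, 1]` is contractible. [folklore] -/
theorem contractibleSpace_K : ContractibleSpace (intervalFamily.K t₀) := by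
  change ContractibleSpace ↥(closure (intervalFamily.fibre t₀))
  rw [closure_fibre_eq ht]
  refine Convex.contractibleSpace (fun x hx y hy a b _ _ _ => ?_) ⟨fun _ => 0, by simp⟩
  have hx' : x 0 ∈ Icc (0 : ℝ) 1 := hx
  have hy' : y 0 ∈ Icc (0 : ℝ) 1 := hy
  simp only [mem_coordSet_iff, Pi.add_apply, Pi.smul_apply, smul_eq_mul, mem_Icc] at hx' hy' ⊢
  constructor <;> nlinarith [hx'.1, hx'.2, hy'.1, hy'.2]

omit ht in
/-- The complex fibre `X_t = ℂ¹` is contractible. [folklore] -/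
theorem contractibleSpace_X (t : ℂ) : ContractibleSpace (intervalFamily.X t) := by
  rw [X_eq]
  exact convex_univ.contractibleSpace univ_nonempty

/-- **Two-point retracts.** The inclusion of the boundary `{0, 1}` into a subset `V ⊆ ℝ¹` avoiding a level
`c ∈ (0, 1)`, star-shaped about `0` to the left of `c` and about `1` to the right of `c`, is a homotopy
equivalence (retraction `y ↦ 0` resp. `1`, straight-line homotopy), hence induces isomorphisms on homology
([HatcherAT2002, Cor. 2.11]). [cite: HatcherAT2002, Cor. 2.11] -/
theorem isIso_map_restrict_Kfr {V : Set (Fin 1 → ℝ)} {c : ℝ} (hc0 : 0 < c) (hc1 : c < 1)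
    (hVc : ∀ y ∈ V, y 0 ≠ c)
    (hV0 : ∀ y ∈ V, y 0 < c → ∀ s ∈ unitInterval, (fun _ => s * y 0 : Fin 1 → ℝ) ∈ V)
    (hV1 : ∀ y ∈ V, c < y 0 → ∀ s ∈ unitInterval, (fun _ => 1 - s + s * y 0 : Fin 1 → ℝ) ∈ V)
    (hKV : MapsTo (intervalFamily.valK t₀) (intervalFamily.Kfr t₀) V) (k : ℕ) :
    IsIso (singularHomology.map ℚ ℚ (subsetRestrict (intervalFamily.valK t₀) hKV) k) := by
  classical
  set f := subsetRestrict (intervalFamily.valK t₀) hKV with hf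
  -- the retraction `g : V → {0, 1}`
  let gfun : V → intervalFamily.Kfr t₀ := fun y =>
    if (y : Fin 1 → ℝ) 0 < c then bpt₀ ht else bpt₁ ht
  have hg : Continuous gfun := by
    refine ((IsLocallyConstant.iff_exists_open gfun).2 fun y => ?_).continuous
    by_cases hy : (y : Fin 1 → ℝ) 0 < c
    · refine ⟨{y' : V | (y' : Fin 1 → ℝ) 0 < c}, ?_, hy, fun y' hy' => ?_⟩
      · exact isOpen_lt ((continuous_apply 0).comp continuous_subtype_val) continuous_const
      · simp only [gfun, if_pos hy, if_pos (show (y' : Fin 1 → ℝ) 0 < c from hy')]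
    · have hy' : c < (y : Fin 1 → ℝ) 0 := lt_of_le_of_ne (not_lt.1 hy) (hVc _ y.2).symm
      refine ⟨{y' : V | c < (y' : Fin 1 → ℝ) 0}, ?_, hy', fun y'' hy'' => ?_⟩
      · exact isOpen_lt continuous_const ((continuous_apply 0).comp continuous_subtype_val)
      · have h1 : ¬ (y'' : Fin 1 → ℝ) 0 < c := not_lt.2 (le_of_lt hy'')
        simp only [gfun, if_neg hy, if_neg h1]
  let g : C(V, intervalFamily.Kfr t₀) := ⟨gfun, hg⟩
  have hval : ∀ y : V, (((g y : intervalFamily.Kfr t₀) : intervalFamily.K t₀) : Fin 1 → ℝ) =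
      fun _ => if (y : Fin 1 → ℝ) 0 < c then (0 : ℝ) else 1 := by
    intro y
    by_cases hy : (y : Fin 1 → ℝ) 0 < c
    · simp only [g, gfun, ContinuousMap.coe_mk, if_pos hy]; rfl
    · simp only [g, gfun, ContinuousMap.coe_mk, if_neg hy]; rfl
  -- `g ∘ f = 𝟙`
  have hgf : g.comp f = ContinuousMap.id _ := by
    ext x : 1
    simp only [ContinuousMap.comp_apply, ContinuousMap.id_apply]
    have hfx : ((f x : V) : Fin 1 → ℝ) = ((x : intervalFamily.K t₀) : Fin 1 → ℝ) := rfl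
    rcases (mem_Kfr_iff ht (x : intervalFamily.K t₀)).1 x.2 with h0 | h1
    · have hlt : ((f x : V) : Fin 1 → ℝ) 0 < c := by rw [hfx, h0]; exact hc0
      change gfun (f x) = x
      simp only [gfun, if_pos hlt]
      apply Subtype.ext; apply Subtype.ext
      exact fin1_eq_iff.2 (by simp [bpt₀, kpt, h0])
    · have hnlt : ¬ ((f x : V) : Fin 1 → ℝ) 0 < c := by rw [hfx, h1]; exact not_lt.2 hc1.le
      change gfun (f x) = x
      simp only [gfun, if_neg hnlt]
      apply Subtype.ext; apply Subtype.ext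
      exact fin1_eq_iff.2 (by simp [bpt₁, kpt, h1])
  -- the straight-line homotopy `f ∘ g ≃ 𝟙` inside `V`
  have hmem : ∀ (s : unitInterval) (y : V),
      ((1 - (s : ℝ)) • (((g y : intervalFamily.Kfr t₀) : intervalFamily.K t₀) : Fin 1 → ℝ) +
        (s : ℝ) • (y : Fin 1 → ℝ)) ∈ V := by
    intro s y
    rw [hval y]
    by_cases hy : (y : Fin 1 → ℝ) 0 < c
    · simp only [if_pos hy]
      convert hV0 _ y.2 hy s s.2 using 1
      exact fin1_eq_iff.2 (by simp only [Pi.add_apply, Pi.smul_apply, smul_eq_mul, mul_zero, zero_add])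
    · have hy' : c < (y : Fin 1 → ℝ) 0 := lt_of_le_of_ne (not_lt.1 hy) (hVc _ y.2).symm
      simp only [if_neg hy]
      convert hV1 _ y.2 hy' s s.2 using 1
      exact fin1_eq_iff.2 (by simp only [Pi.add_apply, Pi.smul_apply, smul_eq_mul, mul_one])
  have hcg : Continuous fun p : unitInterval × V =>
      (((g p.2 : intervalFamily.Kfr t₀) : intervalFamily.K t₀) : Fin 1 → ℝ) :=
    continuous_subtype_val.comp (continuous_subtype_val.comp (g.continuous.comp continuous_snd))
  have hcs : Continuous fun p : unitInterval × V => ((p.1 : unitInterval) : ℝ) :=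
    continuous_subtype_val.comp continuous_fst
  let F : ContinuousMap.Homotopy (f.comp g) (ContinuousMap.id V) :=
    { toFun := fun p => ⟨(1 - (p.1 : ℝ)) • (((g p.2 : intervalFamily.Kfr t₀) : intervalFamily.K t₀) :
          Fin 1 → ℝ) + (p.1 : ℝ) • (p.2 : Fin 1 → ℝ), hmem p.1 p.2⟩
      continuous_toFun := by
        refine Continuous.subtype_mk ?_ _
        exact ((continuous_const.sub hcs).smul hcg).add
          (hcs.smul (continuous_subtype_val.comp continuous_snd))
      map_zero_left := fun y => by
        apply Subtype.ext
        simp only [Set.Icc.coe_zero, sub_zero, one_smul, zero_smul, add_zero]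
        rfl
      map_one_left := fun y => by
        apply Subtype.ext
        simp only [Set.Icc.coe_one, sub_self, zero_smul, one_smul, zero_add]
        rfl }
  have hfg : (f.comp g).Homotopic (ContinuousMap.id V) := ⟨F⟩
  have hgf' : (g.comp f).Homotopic (ContinuousMap.id _) := by
    rw [hgf]
  exact isIso_map_of_homotopyInverse ℚ ℚ f g hgf' hfg k

/-- The centre `1/2` of the fibre lies in the fibre interior. [folklore] -/
theorem half_mem_interior : (fun _ => (1 / 2 : ℝ)) ∈ interior (intervalFamily.fibre t₀) := by
  rw [interior_fibre_eq ht]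
  norm_num

/-- **`H₁(σ̄_{t₀}, ∂σ_{t₀}; ℚ) ≅ H₁(ℝ¹ | σ°_{t₀}; ℚ)`** for the interval family: the five lemma, `[0, 1]` and `ℝ`
being contractible and `{0, 1} ⊆ ℝ ∖ (0, 1)` a homotopy equivalence. [cite: HatcherAT2002, §2.1 Thm. 2.16] -/
theorem isIso_toLocalInterior : IsIso (intervalFamily.toLocalInterior t₀) := by
  haveI := contractibleSpace_K ht
  refine isIso_relativeMap_of_isIso ℚ ℚ (intervalFamily.valK t₀)
    (intervalFamily.mapsTo_valK_compl_interior t₀)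
    (fun k => isIso_map_of_contractibleSpace ℚ ℚ _ k) (fun k => ?_) 1
  refine isIso_map_restrict_Kfr ht (c := 1 / 2) one_half_pos (by norm_num) (fun y hy => ?_)
    (fun y hy hy0 s hs => ?_) (fun y hy hy1 s hs => ?_) _ k
  · rw [interior_fibre_eq ht] at hy
    intro h
    exact hy (by simp only [mem_coordSet_iff, h]; norm_num)
  · rw [interior_fibre_eq ht] at hy ⊢
    simp only [mem_compl_iff, mem_coordSet_iff, mem_Ioo, not_and, not_lt] at hy ⊢
    intro h
    have hy0' : y 0 ≤ 0 := le_of_not_gt fun h' => by linarith [hy h']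
    exact absurd h (not_lt.2 (mul_nonpos_of_nonneg_of_nonpos hs.1 hy0'))
  · rw [interior_fibre_eq ht] at hy ⊢
    simp only [mem_compl_iff, mem_coordSet_iff, mem_Ioo, not_and, not_lt] at hy ⊢
    intro _
    have hy1' : 1 ≤ y 0 := hy (lt_trans one_half_pos hy1)
    nlinarith [hs.1, hs.2]

/-- The local image map at the centre, `H₁(σ̄_{t₀}, ∂σ_{t₀}; ℚ) → H₁(ℝ¹ | 1/2; ℚ)`, is an isomorphism
(five lemma; `{0, 1} ⊆ ℝ ∖ {1/2}` is a homotopy equivalence). [cite: HatcherAT2002, §2.1 Thm. 2.16] -/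
theorem isIso_map_half :
    IsIso (relativeSingularHomology.map ℚ ℚ (intervalFamily.valK t₀)
      (intervalFamily.mapsTo_subtype_val_Kfr t₀ (half_mem_interior ht)) 1) := by
  haveI := contractibleSpace_K ht
  refine isIso_relativeMap_of_isIso ℚ ℚ _ _ (fun k => isIso_map_of_contractibleSpace ℚ ℚ _ k)
    (fun k => ?_) 1
  refine isIso_map_restrict_Kfr ht (c := 1 / 2) one_half_pos (by norm_num) (fun y hy => ?_)
    (fun y hy hy0 s hs => ?_) (fun y hy hy1 s hs => ?_) _ k
  · intro h
    exact hy (mem_singleton_iff.2 (fin1_eq_iff.2 (by simpa using h)))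
  · intro h
    have h' : s * y 0 = 1 / 2 := by simpa using fin1_eq_iff.1 (mem_singleton_iff.1 h)
    rcases le_or_gt (y 0) 0 with h0 | h0
    · have := mul_nonpos_of_nonneg_of_nonpos hs.1 h0
      linarith
    · have := mul_le_of_le_one_left h0.le hs.2
      linarith
  · intro h
    have h' : 1 - s + s * y 0 = 1 / 2 := by simpa using fin1_eq_iff.1 (mem_singleton_iff.1 h)
    rcases eq_or_lt_of_le hs.2 with rfl | hs1
    · simp at h'
      linarith
    · nlinarith [mul_nonneg hs.1 (sub_nonneg.2 hy1.le)]

/-- `t₀ ∈ J`. [folklore] -/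
theorem mem_J : t₀ ∈ intervalFamily.J := mem_J_iff.2 ht

/-- The comparison map `∂σ_{t₀} = {0, 1} → D_{t₀} = {0, 1} ⊆ ℂ` is bijective. [folklore] -/
theorem bijective_restrict_realIncl :
    Function.Bijective (subsetRestrict (intervalFamily.realIncl t₀ (mem_J ht))
      (intervalFamily.mapsTo_realIncl t₀ (mem_J ht))) := by
  constructor
  · intro x y hxy
    apply Subtype.ext
    apply Subtype.ext
    have h := congrArg (fun z : intervalFamily.D (t₀ : ℂ) => ((z : intervalFamily.X (t₀ : ℂ)) : Fin 1 → ℂ) 0) hxy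
    have h' : ((((x : intervalFamily.K t₀) : Fin 1 → ℝ) 0 : ℝ) : ℂ) =
        ((((y : intervalFamily.K t₀) : Fin 1 → ℝ) 0 : ℝ) : ℂ) := h
    exact fin1_eq_iff.2 (by exact_mod_cast h')
  · intro z
    rcases mem_D_iff.1 z.2 with h0 | h1
    · refine ⟨bpt₀ ht, ?_⟩
      apply Subtype.ext
      apply Subtype.ext
      funext i
      rw [Subsingleton.elim i 0]
      change ((((bpt₀ ht : intervalFamily.Kfr t₀) : intervalFamily.K t₀) : Fin 1 → ℝ) 0 : ℂ) =
        ((z : intervalFamily.X (t₀ : ℂ)) : Fin 1 → ℂ) 0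
      rw [h0]
      simp [bpt₀, kpt]
    · refine ⟨bpt₁ ht, ?_⟩
      apply Subtype.ext
      apply Subtype.ext
      funext i
      rw [Subsingleton.elim i 0]
      change ((((bpt₁ ht : intervalFamily.Kfr t₀) : intervalFamily.K t₀) : Fin 1 → ℝ) 0 : ℂ) =
        ((z : intervalFamily.X (t₀ : ℂ)) : Fin 1 → ℂ) 0
      rw [h1]
      simp [bpt₁, kpt]

/-- **`H₁([0, 1], {0, 1}; ℚ) ≅ H₁(ℂ, {0, 1}; ℚ)`** along the comparison map of pairs `realIncl` of the interval
family: the five lemma, `[0, 1]` and `ℂ` being contractible and `{0, 1} → {0, 1}` a homeomorphism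
([HuberMullerStachPeriodsIII2015, Lemma 11.2.3]: the class of `[0, 1]` generates `H₁(ℂ, {0, 1}; ℚ) = ℚ`).
[cite: HatcherAT2002, §2.1 Thm. 2.16] -/
theorem isIso_map_realIncl :
    IsIso (relativeSingularHomology.map ℚ ℚ (intervalFamily.realIncl t₀ (mem_J ht))
      (intervalFamily.mapsTo_realIncl t₀ (mem_J ht)) 1) := by
  haveI := contractibleSpace_K ht
  haveI := contractibleSpace_X (t₀ : ℂ)
  refine isIso_relativeMap_of_isIso ℚ ℚ _ _ (fun k => isIso_map_of_contractibleSpace ℚ ℚ _ k)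
    (fun k => ?_) 1
  haveI : CompactSpace (intervalFamily.K t₀) :=
    isCompact_iff_compactSpace.mp (intervalFamily.isCompact_closure_fibre t₀)
  haveI : CompactSpace (intervalFamily.Kfr t₀) :=
    isCompact_iff_compactSpace.mp ((isClosed_frontier.preimage continuous_subtype_val).isCompact)
  let e : intervalFamily.Kfr t₀ ≃ₜ intervalFamily.D (t₀ : ℂ) :=
    Continuous.homeoOfEquivCompactToT2 (f := Equiv.ofBijective _ (bijective_restrict_realIncl ht))
      (subsetRestrict (intervalFamily.realIncl t₀ (mem_J ht))
        (intervalFamily.mapsTo_realIncl t₀ (mem_J ht))).continuous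
  have he : (e : C(intervalFamily.Kfr t₀, intervalFamily.D (t₀ : ℂ))) =
      subsetRestrict (intervalFamily.realIncl t₀ (mem_J ht))
        (intervalFamily.mapsTo_realIncl t₀ (mem_J ht)) := by
    ext
    rfl
  rw [← he]
  exact inferInstanceAs (IsIso (singularHomology.mapIso ℚ ℚ e k).hom)

/-- **The fibres of the interval family are monodromy-cyclic**: the Betti class `c = [σ_{t₀}] ∈ H₁(ℂ, {0, 1}; ℚ)`
spans (`H₁([0,1], {0,1}; ℚ) = ℚ · φ` for the fundamental class `φ`, transported by the isomorphism
`H₁([0,1], {0,1}) ≅ H₁(ℂ, {0,1})`), and `c` lies in its own monodromy orbit.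
[cite: HuberMullerStachPeriodsIII2015, Lemma 11.2.3] -/
theorem isMonodromyCyclicAt : intervalFamily.IsMonodromyCyclicAt t₀ := by
  have hJ : t₀ ∈ intervalFamily.J := mem_J ht
  have hgood : (t₀ : ℂ) ∈ intervalFamily.goodLocus := by
    rw [goodLocus_eq]
    exact mem_univ _
  -- a fundamental class of `([0, 1], {0, 1})`
  haveI := isIso_toLocalInterior ht
  have hsurj : Function.Surjective (intervalFamily.toLocalInterior t₀) :=
    (ModuleCat.epi_iff_surjective _).1 inferInstance
  obtain ⟨μ, φ, hφ⟩ := intervalFamily.exists_isFundamentalClassOf_of_surjective le_rfl t₀ hsurj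
  -- it spans `H₁([0, 1], {0, 1}; ℚ)`
  haveI := isIso_map_half ht
  have hinj : Function.Injective (relativeSingularHomology.map ℚ ℚ (intervalFamily.valK t₀)
      (intervalFamily.mapsTo_subtype_val_Kfr t₀ (half_mem_interior ht)) 1) :=
    (ModuleCat.mono_iff_injective _).1 inferInstance
  have hspan := intervalFamily.exists_eq_smul_of_injective t₀ hφ (half_mem_interior ht) hinj
  -- transport to the complex pair `(ℂ, {0, 1})`
  haveI := isIso_map_realIncl ht
  have hsurj' : Function.Surjective (relativeSingularHomology.map ℚ ℚ
      (intervalFamily.realIncl t₀ hJ) (intervalFamily.mapsTo_realIncl t₀ hJ) 1) :=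
    (ModuleCat.epi_iff_surjective _).1 inferInstance
  refine ⟨hJ, hgood, _, ⟨μ, φ, hφ, rfl⟩, ?_⟩
  rw [eq_top_iff]
  rintro v -
  obtain ⟨u, rfl⟩ := hsurj' v
  obtain ⟨q, rfl⟩ := hspan u
  rw [map_smul]
  exact Submodule.smul_mem _ _ (Submodule.subset_span
    (intervalFamily.self_mem_monodromyOrbit hgood _))

end Fibre

end intervalFamily

/-! ### The monodromy-cyclic interval family -/

/-- **The interval family is a monodromy-cyclic family** (non-vacuity of `MonodromyCyclicFamily`): every fibre
`σ_t = (0, 1)`, `t ∈ (0, 1)`, is monodromy-cyclic, `H₁(ℂ, {0, 1}; ℚ) = ℚ · [0, 1]`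
([HuberMullerStachPeriodsIII2015, Lemma 11.2.3]; [VoisinHodgeII2003, Def. 3.13] with trivial monodromy).
[cite: HuberMullerStachPeriodsIII2015, Lemma 11.2.3] -/
def MonodromyCyclicFamily.interval : MonodromyCyclicFamily 1 where
  toPeriodFamily := intervalFamily
  cyclic _ ht := intervalFamily.isMonodromyCyclicAt (intervalFamily.mem_J_iff.1 ht)

/-- The underlying period family of the interval family. [folklore] -/
@[simp] theorem MonodromyCyclicFamily.interval_toPeriodFamily :
    MonodromyCyclicFamily.interval.toPeriodFamily = intervalFamily := rfl

/-- Monodromy-cyclic families exist. [folklore] -/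
instance : Inhabited (MonodromyCyclicFamily 1) := ⟨MonodromyCyclicFamily.interval⟩

end Literature.AlgebraicGeometry.Motives
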